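import Summits.ValiantsHypothesis.ValiantsHypothesis.Theorems.DivisionGapPerDivisionHardStubSparseRigidCount
import Summits.ValiantsHypothesis.ValiantsHypothesis.Theorems.DivisionGapDefs

/-!
# Crux `DivisionGap.PerDivisionHard` (stmt-ValiantsHypothesis-5065), line `pair-descent-jss-endpoint` —
stub `stub_altRowEquiv`: an alternating row labelling of the block arsenal

`stub_altRowEquiv`: if `n = b + b·(b·k) + m` and both a row set `A ⊆ Fin n` and its complement have
at least `b + b·(b·k)` elements, some labelling `eR : BlockV b k m ≃ Fin n` of the rows by the
vertex labels of `G(b,k) ⊕ M₀` puts the internal row `(i, j, t)` into `A` iff `t` is even (so the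
internal rows of every subdivided path alternate between `A` and its complement; hub rows and
padding rows go anywhere).

Proof (pure cardinal bookkeeping, as `exists_blockEquiv` of `StubSparseRigidCount.lean`).
`exists_sumFinEquiv_mem_iff`: for a finite type `α` of cardinality `c` with a decidable predicate
`P`, `c + m = n`, `c ≤ |A|` and `c ≤ n - |A|`, split `α = {P} ⊕ {¬P}` (`Equiv.sumCompl`) and the
padding `Fin m = Fin m₁ ⊕ Fin m₂` with `m₁ = |A| - |{P}|` (`finSumFinEquiv`); then
`|{P} ⊕ Fin m₁| = |A|` and `|{¬P} ⊕ Fin m₂| = n - |A|`, so `Fintype.equivOfCardEq` matches the two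
halves with `{r // r ∈ A}` and `{r // r ∉ A}`, and `Equiv.sumCompl (· ∈ A)` reassembles `Fin n`
(the four-way shuffle is `Equiv.sumSumSumComm`, evaluated by `simp`).  The stub is the case
`α = Fin b ⊕ (Fin b × Fin b × Fin k)`, `P` = "internal label with `t` even", composed with
`Equiv.sumAssoc`.
-/

noncomputable section

-- `Summit.ValiantsHypothesis.ValiantsHypothesis.…` is the tree's mandated single-conjunct layout
-- (Sub = Summit), so the duplicated namespace component is intended.
set_option linter.dupNamespace false

namespace Summit.ValiantsHypothesis.ValiantsHypothesis.Theorems.DivisionGapPerDivisionHard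

/-- **Labelling with a prescribed membership pattern.**  If `card α = c`, `c + m = n`, and both a
set `A ⊆ Fin n` and its complement have at least `c` elements, then for every decidable predicate
`P` on `α` some bijection `α ⊕ Fin m ≃ Fin n` sends `x : α` into `A` iff `P x` (the padding `Fin m`
absorbs the slack on both sides). [folklore] -/
theorem exists_sumFinEquiv_mem_iff {α : Type*} [Fintype α] (P : α → Prop) [DecidablePred P]
    {c m n : ℕ} (A : Finset (Fin n)) (hc : Fintype.card α = c) (hn : c + m = n)
    (hA : c ≤ A.card) (hAc : c ≤ n - A.card) :
    ∃ e : α ⊕ Fin m ≃ Fin n, ∀ x, e (Sum.inl x) ∈ A ↔ P x := by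
  classical
  have hPN : Fintype.card {x // P x} + Fintype.card {x // ¬P x} = c := by
    rw [← hc, ← Fintype.card_sum]
    exact Fintype.card_congr (Equiv.sumCompl P)
  have hAn : A.card ≤ n := A.card_le_univ.trans_eq (Fintype.card_fin n)
  obtain ⟨m₁, hm₁⟩ : ∃ m₁, Fintype.card {x // P x} + m₁ = A.card :=
    ⟨A.card - Fintype.card {x // P x}, by omega⟩
  obtain ⟨m₂, hm₂⟩ : ∃ m₂, m₁ + m₂ = m := ⟨m - m₁, by omega⟩
  have h1 : Fintype.card ({x // P x} ⊕ Fin m₁) = Fintype.card {r // r ∈ A} := by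
    rw [Fintype.card_sum, Fintype.card_fin, Fintype.card_coe, hm₁]
  have h2 : Fintype.card ({x // ¬P x} ⊕ Fin m₂) = Fintype.card {r // r ∉ A} := by
    simp only [Fintype.card_sum, Fintype.card_fin, Fintype.card_subtype_compl, Fintype.card_coe]
    omega
  let e₁ := Fintype.equivOfCardEq h1
  let e₂ := Fintype.equivOfCardEq h2
  let ef : Fin m ≃ Fin m₁ ⊕ Fin m₂ := (finCongr hm₂.symm).trans finSumFinEquiv.symm
  refine ⟨((Equiv.sumCompl P).symm.sumCongr ef).trans ((Equiv.sumSumSumComm _ _ _ _).trans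
    ((e₁.sumCongr e₂).trans (Equiv.sumCompl (· ∈ A)))), fun x => ?_⟩
  by_cases hP : P x
  · simp [Equiv.sumCompl_symm_apply_of_pos hP, hP]
  · have h := (e₂ (Sum.inl ⟨x, hP⟩)).2
    simpa [Equiv.sumCompl_symm_apply_of_neg hP, hP] using h

/-- **`stub_altRowEquiv` — an alternating row labelling exists.**  If `n = b + b·(b·k) + m` and
both `A ⊆ Fin n` and its complement have at least `b + b·(b·k)` elements, some labelling
`eR : BlockV b k m ≃ Fin n` puts the internal row `(i, j, t)` into `A` iff `t` is even.
[folklore] -/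
theorem stub_altRowEquiv :
    ∀ (b k m n : ℕ) (A : Finset (Fin n)), b + b * (b * k) + m = n →
      b + b * (b * k) ≤ A.card → b + b * (b * k) ≤ n - A.card →
      ∃ eR : BlockV b k m ≃ Fin n,
        ∀ (i j : Fin b) (t : Fin k), eR (Sum.inr (Sum.inl (i, j, t))) ∈ A ↔ (t : ℕ) % 2 = 0 := by
  intro b k m n A hn hA hAc
  classical
  obtain ⟨e, he⟩ := exists_sumFinEquiv_mem_iff
    (Sum.elim (fun _ : Fin b => False) fun p : Fin b × Fin b × Fin k => (p.2.2 : ℕ) % 2 = 0)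
    A (by simp only [Fintype.card_sum, Fintype.card_fin, Fintype.card_prod]) hn hA hAc
  refine ⟨(Equiv.sumAssoc _ _ _).symm.trans e, fun i j t => ?_⟩
  simpa using he (Sum.inr (i, j, t))

end Summit.ValiantsHypothesis.ValiantsHypothesis.Theorems.DivisionGapPerDivisionHard
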